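import Summits.RiemannHypothesis.RiemannHypothesis.Theses.EarlyAppointments
import Literature.Analysis.Complex.FourierPolyaKiKimProofs
import Literature.NumberTheory.LFunctions.XiMultiplePositivityProofs
import Literature.NumberTheory.LFunctions.RiemannXiProofs

/-!
# COSTUME CERTIFICATE for route `EarlyAppointments` (crux-strategist r1, stmt-RiemannHypothesis-3183)

Claim certified here (sorry-free): the route's "target" `HereditaryLaguerre`
(stmt-RiemannHypothesis-3182) ALONE decides the sub-problem statement:

  `rh_of_hereditaryLaguerre : HereditaryLaguerre → Summit.RiemannHypothesis`

using only tree theorems — the PROVED Ki–Kim 2000 Thm 4.3 engine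
(`Literature/Analysis/Complex/FourierPolyaKiKim*.lean`: `KiKim.noCrit_re_of_gammaChain`,
`KiKim.im_eq_zero_of_noCrit_of_order_lt_one`, `KiKim.re_iteratedDeriv_zero_mul_succ_neg`,
`KiKim.re_iteratedDeriv_ne_zero_of_neg`), the order-`< 1` companion `xiSq` of `Ξ`
(`xiSq_sq`, `norm_xiSq_le`, `xiSq_conj`, `xiSq_zero`, `riemannXi_half_re_pos`) and Riemann's
reformulation `riemannHypothesis_iff_im_eq_zero_of_riemannXiUpper_eq_zero_holds`.

Consequences:
* the deciding theorem `closes (hLaw : LogCombLandingLaw) (hXi : XiInLogCombClass)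
  (hX : HereditaryLaguerre)` of the route has a strictly smaller cone: `hLaw` and `hXi` are NOT
  load-bearing (`closes_without_law` below has the same conclusion from `hX` only);
* the route's assembly item (stmt-RiemannHypothesis-3189,
  `Assembly := LogCombLandingLaw → XiInLogCombClass → HereditaryLaguerre → Summit.RiemannHypothesis`)
  holds with the first two hypotheses discarded (`assembly_without_law`);
* with the classical converse `RH → HereditaryLaguerre` (Laguerre–Pólya heredity; the route's own
  support item `LaguerreHeredityOfRH`, stmt-RiemannHypothesis-3188) the open content of the route is
  `HereditaryLaguerre ≡ RH` — the Fourier–Pólya form of RH [KiKim2000, Thm 4.3; Kim1996] — and the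
  crux `LogCombLandingLaw` (stmt-3183) carries no summit content: it is a quantitative re-proof
  (depth/drift `≤ C log²`) of the direction that is already a theorem.
-/

set_option linter.dupNamespace false

noncomputable section

namespace Summit.RiemannHypothesis.RiemannHypothesis.Cruxes.LogCombLandingLaw.Costume

open Literature.NumberTheory.LFunctions
open Literature.Analysis.Complex
open Summit.RiemannHypothesis.RiemannHypothesis.Theses.EarlyAppointments
open scoped ComplexConjugate

/-- The order-`< 1` companion of `Ξ`: `G(w) = ξ₁(−w)`, so that `G(z²) = Ξ(z)`. [folklore] -/
def G (w : ℂ) : ℂ := xiSq (-w)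

/-- `G(z²) = Ξ(z)`: `Ξ(z) = ξ(1/2 + iz) = ξ₁((iz)²) = ξ₁(−z²)`. [folklore] -/
theorem G_sq (z : ℂ) : G (z ^ 2) = riemannXiUpper z := by
  unfold G riemannXiUpper
  have h : -(z ^ 2) = (Complex.I * z) ^ 2 := by
    rw [mul_pow, Complex.I_sq]; ring
  rw [h, xiSq_sq]

/-- `G` is entire. [folklore] -/
theorem differentiable_G : Differentiable ℂ G :=
  differentiable_xiSq.comp differentiable_neg

/-- `G` is real on the real axis (Schwarz reflection for `ξ₁`). [folklore] -/
theorem G_real (x : ℝ) : (G x).im = 0 := by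
  unfold G
  have h : conj (xiSq (-(x : ℂ))) = xiSq (-(x : ℂ)) := by
    rw [← xiSq_conj, map_neg, Complex.conj_ofReal]
  exact Complex.conj_eq_iff_im.mp h

/-- `G(0) = ξ(1/2)` has positive real part. [folklore] -/
theorem G_zero_re_ne : (G 0).re ≠ 0 := by
  unfold G
  rw [neg_zero, xiSq_zero]
  exact riemannXi_half_re_pos.ne'

/-- `G(0) ≠ 0`. [folklore] -/
theorem G_zero_ne : G 0 ≠ 0 := by
  unfold G
  rw [neg_zero]
  exact xiSq_zero_ne

/-- `G` is entire of order `< 1` (Titchmarsh §2.12: `Ξ(√z)` has order `1/2`; tree bound `7/8`). [folklore] -/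
theorem G_orderLtOne : IsEntireOfOrderLt 1 G := by
  obtain ⟨C, hC⟩ := norm_xiSq_le
  refine ⟨differentiable_G, 7 / 8, C, by norm_num, fun w => ?_⟩
  have h := hC (-w)
  rw [norm_neg] at h
  exact h

/-- `Ξ` is entire of order `< 2` (first conjunct of the route's support item `XiInLogCombClass`),
from the order-`< 1` bound for `ξ₁`. [folklore] -/
theorem isEntireOfOrderLt_two_riemannXiUpper : IsEntireOfOrderLt 2 riemannXiUpper := by
  obtain ⟨C, hC⟩ := norm_xiSq_le
  refine ⟨?_, 7 / 4, C, by norm_num, fun z => ?_⟩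
  · have h : riemannXiUpper = fun z => G (z ^ 2) := by
      funext z; rw [G_sq]
    rw [h]
    exact differentiable_G.comp (differentiable_pow 2)
  · have h := hC (-(z ^ 2))
    rw [norm_neg, norm_pow] at h
    have hz : (‖z‖ ^ 2) ^ (7 / 8 : ℝ) = ‖z‖ ^ (7 / 4 : ℝ) := by
      rw [← Real.rpow_natCast, ← Real.rpow_mul (norm_nonneg z)]
      norm_num
    rw [hz] at h
    rw [← G_sq]
    exact h

/-- **`HereditaryLaguerre` ⟹ every zero of `Ξ` is real** (Ki–Kim 2000, Thm 4.3 with `K = 0`,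
run on the tree's PROVED engine, specialised to `f = Ξ`: no division step is needed since
`Ξ(0) = ξ(1/2) ≠ 0`, and the order-`< 1` function `G` with `G(z²) = Ξ(z)` is the tree's `ξ₁(−w)`).
[cite: KiKim2000, Theorem 4.3] -/
theorem xi_zeros_real_of_hereditaryLaguerre (hX : HereditaryLaguerre) :
    ∀ z : ℂ, riemannXiUpper z = 0 → z.im = 0 := by
  have hHγ : HasNoFourierCriticalPoint (fun s : ℝ => (G ((s : ℂ) ^ 2)).re) := by
    have h : (fun s : ℝ => (G ((s : ℂ) ^ 2)).re) = fun t : ℝ => (riemannXiUpper (t : ℂ)).re := by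
      funext s; rw [G_sq]
    rw [h]
    exact hX
  have hHG : HasNoFourierCriticalPoint (fun t : ℝ => (G t).re) :=
    KiKim.noCrit_re_of_gammaChain differentiable_G G_real G_zero_re_ne hHγ
  intro z hz
  have hzsq : G (z ^ 2) = 0 := by rw [G_sq]; exact hz
  have him2 : (z ^ 2).im = 0 :=
    KiKim.im_eq_zero_of_noCrit_of_order_lt_one G_orderLtOne G_zero_ne G_real hHG (z ^ 2) hzsq
  have hre2 : 0 ≤ (z ^ 2).re := by
    by_contra hneg
    push Not at hneg
    have halt := KiKim.re_iteratedDeriv_zero_mul_succ_neg differentiable_G G_zero_re_ne hHγ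
    have h1 := KiKim.re_iteratedDeriv_ne_zero_of_neg differentiable_G G_real halt 0 hneg
    have h2 : z ^ 2 = (((z ^ 2).re : ℝ) : ℂ) := Complex.ext (by simp) (by simpa using him2)
    rw [h2] at hzsq
    simp only [iteratedDeriv_zero] at h1
    exact h1 (by rw [hzsq]; simp)
  have him : (z ^ 2).im = 2 * z.re * z.im := by simp [sq, Complex.mul_im]; ring
  have hre : (z ^ 2).re = z.re * z.re - z.im * z.im := by simp [sq, Complex.mul_re]
  rw [him] at him2
  rw [hre] at hre2
  by_contra hzim
  have hzre : z.re = 0 := by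
    rcases mul_eq_zero.mp him2 with h | h
    · rcases mul_eq_zero.mp h with h' | h'
      · norm_num at h'
      · exact h'
    · exact absurd h hzim
  rw [hzre] at hre2
  have : 0 < z.im * z.im := mul_self_pos.mpr hzim
  linarith

/-- **THE COSTUME THEOREM.** The route's "target" item ALONE decides the sub-problem:
`HereditaryLaguerre → Summit.RiemannHypothesis`, by Ki–Kim 2000 Thm 4.3 (PROVED in tree) and
Riemann's reformulation (PROVED in tree). No `LogCombLandingLaw`, no `XiInLogCombClass`.
[cite: KiKim2000, Theorem 4.3] -/
theorem rh_of_hereditaryLaguerre (hX : HereditaryLaguerre) : _root_.Summit.RiemannHypothesis :=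
  riemannHypothesis_iff_im_eq_zero_of_riemannXiUpper_eq_zero_holds.2
    (xi_zeros_real_of_hereditaryLaguerre hX)

/-- The route's deciding theorem with the crux and the class-membership support DISCARDED: same
conclusion from `HereditaryLaguerre` only — `LogCombLandingLaw` is not load-bearing. [folklore] -/
theorem closes_without_law (_hLaw : LogCombLandingLaw) (_hXi : XiInLogCombClass)
    (hX : HereditaryLaguerre) : _root_.Summit.RiemannHypothesis :=
  rh_of_hereditaryLaguerre hX

/-- The route's assembly item (stmt-RiemannHypothesis-3189) holds with the law unused. [folklore] -/
theorem assembly_without_law : Assembly :=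
  fun _ _ hX => rh_of_hereditaryLaguerre hX

/-- Hence, over the tree, the target is AT LEAST the summit: any proof of `HereditaryLaguerre` is a
proof of RH outright; together with the classical converse (`LaguerreHeredityOfRH`, stmt-3188:
RH ⟹ Ξ ∈ L–P ⟹ hereditary strict Laguerre) the target is RH restated. [folklore] -/
theorem hereditaryLaguerre_iff_rh (hconv : LaguerreHeredityOfRH) :
    HereditaryLaguerre ↔ _root_.Summit.RiemannHypothesis :=
  ⟨rh_of_hereditaryLaguerre, hconv⟩

end Summit.RiemannHypothesis.RiemannHypothesis.Cruxes.LogCombLandingLaw.Costume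

end
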